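import Mathlib.AlgebraicGeometry.Morphisms.Smooth
import Mathlib.RingTheory.Smooth.StandardSmoothCotangent
import HarnessLib

/-!
# Smooth morphisms: affine charts with an exact basis of Kähler differentials

Topic `Literature/AlgebraicGeometry/Smoothening`; theorems only (no definition, no named fact).

For a morphism of schemes `f : X → Spec k` (`k` any commutative ring) which is smooth of relative
dimension `n` (Mathlib's `AlgebraicGeometry.SmoothOfRelativeDimension n f`: Zariski-locally on
source and target the ring maps are standard smooth of relative dimension `n`, Stacks Project
Tag 01V4 / 00T6), every point `x ∈ X` has an affine open neighbourhood `V` together with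
functions `y₁, …, yₙ ∈ Γ(X, V)` whose differentials `dy₁, …, dyₙ` form a basis of the module of
Kähler differentials `Ω[Γ(X, V)⁄k]` (Stacks Project Tag 00T7 (2): for a standard smooth
presentation `S = k[x₁,…,x_N]/(f₁,…,f_c)` with invertible Jacobian in the first `c` variables,
`Ω_{S/k}` is free on the `dx_i`, `i > c`; EGA IV 17.15.5).  Proof: an affine open `U ∋ x`;
`Γ(Spec k) → Γ(X, U)` is LOCALLY standard smooth of relative dimension `n`
(`HasRingHomProperty.appLE`), i.e. `Γ(X,U)[1/t]` is standard smooth for `t` running through a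
set generating the unit ideal; one such basic open `V = X_t` contains `x`; transport the
submersive presentation along `Γ(X, V) ≅ Γ(X, U)[1/t]` and take Mathlib's
`SubmersivePresentation.basisKaehler`, re-indexed by `Fin n`.  This is leaf C1 of the (W0)
«birational group law» road (B-p18's decomposition: the chart of a smooth model `𝒳 → Spec R`
and of a group variety `E → Spec K` in which rational top forms are written).

## Content (namespace `Literature.AlgebraicGeometry.Smoothening`)

* `exists_affineChart_basis_eq_D` — the statement above, with the `k`-algebra structure on
  `Γ(X, V)` induced by `Γ(Spec k) ≅ k → Γ(X, ⊤) → Γ(X, V)` (`f.appLE ⊤ V`).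

## References
* The Stacks Project, Tags 00T7 (2), 00TA, 01V4. [StacksProject]
* A. Grothendieck, *EGA* IV₄, 17.15.5.
-/

noncomputable section

universe u

open CategoryTheory AlgebraicGeometry TopologicalSpace

namespace Literature.AlgebraicGeometry.Smoothening

/-- **Affine charts with an exact Kähler basis for a smooth morphism.** Let `f : X → Spec k` be
smooth of relative dimension `n` (`k` any commutative ring). Every `x ∈ X` has an affine open
neighbourhood `V` with `y₁, …, yₙ ∈ Γ(X, V)` such that `dy₁, …, dyₙ` is a basis of
`Ω[Γ(X, V)⁄k]`, for the algebra structure `k = Γ(Spec k) → Γ(X, ⊤) → Γ(X, V)`.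
(Zariski-locally `Γ(X, V)` is standard smooth of relative dimension `n` over `k`, and a
submersive presentation has `Ω` free on the differentials of the free variables.)
[cite: StacksProject, Tag 00T7 (2)] -/
theorem exists_affineChart_basis_eq_D {k : Type u} [CommRing k] {X : Scheme.{u}}
    (f : X ⟶ Spec (.of k)) (n : ℕ) [SmoothOfRelativeDimension n f] (x : X) :
    ∃ (V : X.Opens) (_ : IsAffineOpen V) (_ : x ∈ V) (y : Fin n → Γ(X, V)),
      letI : Algebra k Γ(X, V) :=
        ((Scheme.ΓSpecIso (.of k)).inv ≫ f.appLE ⊤ V le_top).hom.toAlgebra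
      ∃ b : Module.Basis (Fin n) Γ(X, V) Ω[Γ(X, V)⁄k],
        ∀ i, b i = KaehlerDifferential.D k _ (y i) := by
  classical
  -- an affine open neighbourhood `U` of `x`
  obtain ⟨U, hU, hxU, -⟩ :=
    exists_isAffineOpen_mem_and_subset (X := X) (x := x) (U := ⊤) (Opens.mem_top x)
  -- `Γ(Spec k, ⊤) → Γ(X, U)` is locally standard smooth of relative dimension `n`
  have hloc : RingHom.Locally (RingHom.IsStandardSmoothOfRelativeDimension n)
      (f.appLE ⊤ U le_top).hom :=
    HasRingHomProperty.appLE (P := @SmoothOfRelativeDimension n) f inferInstance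
      ⟨⊤, isAffineOpen_top _⟩ ⟨U, hU⟩ le_top
  obtain ⟨s, hspan, hs⟩ := hloc
  -- a member `t` of the covering family with `x ∈ X_t`
  have hcover : ⨆ t : s, X.basicOpen (t : Γ(X, U)) = U := hU.iSup_basicOpen_eq_self_iff.mpr hspan
  obtain ⟨⟨t, hts⟩, hxt⟩ : ∃ t : s, x ∈ X.basicOpen (t : Γ(X, U)) := by
    have hx' : x ∈ ⨆ t : s, X.basicOpen (t : Γ(X, U)) := by rw [hcover]; exact hxU
    exact Opens.mem_iSup.mp hx'
  -- the chart `V = X_t`, affine, with `Γ(X, V) = Γ(X, U)[1/t]`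
  refine ⟨X.basicOpen t, hU.basicOpen t, hxt, ?_⟩
  haveI : IsLocalization.Away t Γ(X, X.basicOpen t) := hU.isLocalization_basicOpen t
  let φ : k →+* Γ(X, X.basicOpen t) :=
    ((Scheme.ΓSpecIso (.of k)).inv ≫ f.appLE ⊤ (X.basicOpen t) le_top).hom
  letI : Algebra k Γ(X, X.basicOpen t) := φ.toAlgebra
  -- standard smoothness of `k → Γ(X, U)[1/t]`, transported to `k → Γ(X, X_t)`
  have hst : (((algebraMap Γ(X, U) (Localization.Away t)).comp (f.appLE ⊤ U le_top).hom)).IsStandardSmoothOfRelativeDimension n :=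
    hs t hts
  let e : Localization.Away t ≃ₐ[Γ(X, U)] Γ(X, X.basicOpen t) :=
    IsLocalization.algEquiv (Submonoid.powers t) _ _
  have hφ : (e.toRingEquiv.toRingHom.comp
      ((algebraMap Γ(X, U) (Localization.Away t)).comp (f.appLE ⊤ U le_top).hom)).comp
      (Scheme.ΓSpecIso (.of k)).symm.commRingCatIsoToRingEquiv.toRingHom = φ := by
    have h1 : e.toRingEquiv.toRingHom.comp (algebraMap Γ(X, U) (Localization.Away t)) =
        algebraMap Γ(X, U) Γ(X, X.basicOpen t) :=
      RingHom.ext fun a => e.commutes a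
    have h2 : (algebraMap Γ(X, U) Γ(X, X.basicOpen t)).comp (f.appLE ⊤ U le_top).hom =
        (f.appLE ⊤ (X.basicOpen t) le_top).hom := by
      rw [RingHom.algebraMap_toAlgebra, ← CommRingCat.hom_comp, Scheme.Hom.appLE_map]
    rw [← RingHom.comp_assoc (f := (f.appLE ⊤ U le_top).hom)
      (g := algebraMap Γ(X, U) (Localization.Away t)) (h := e.toRingEquiv.toRingHom), h1, h2]
    rfl
  have hstφ : φ.IsStandardSmoothOfRelativeDimension n := by
    rw [← hφ]
    exact (RingHom.isStandardSmoothOfRelativeDimension_respectsIso (n := n)).2 _ _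
      ((RingHom.isStandardSmoothOfRelativeDimension_respectsIso (n := n)).1 _ _ hst)
  haveI hstd : Algebra.IsStandardSmoothOfRelativeDimension n k Γ(X, X.basicOpen t) :=
    (RingHom.isStandardSmoothOfRelativeDimension_algebraMap n).mp hstφ
  -- a submersive presentation and its Kähler basis, re-indexed by `Fin n`
  obtain ⟨ι, σ, _, _, Pr, hPr⟩ := hstd.out
  haveI : Fintype ι := Fintype.ofFinite ι
  haveI : Fintype σ := Fintype.ofFinite σ
  let b := Pr.basisKaehler
  have hcard : Fintype.card ((Set.range Pr.map)ᶜ : Set ι) = n := by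
    rw [Fintype.card_compl_set, Set.card_range_of_injective Pr.map_inj, ← hPr]
    simp [Algebra.Presentation.dimension, Nat.card_eq_fintype_card]
  let eι : ((Set.range Pr.map)ᶜ : Set ι) ≃ Fin n := Fintype.equivFinOfCardEq hcard
  refine ⟨fun i => Pr.val (eι.symm i : ι), b.reindex eι, fun i => ?_⟩
  rw [Module.Basis.reindex_apply, Algebra.SubmersivePresentation.basisKaehler_apply]

end Literature.AlgebraicGeometry.Smoothening

end
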